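import Summits.CriticalPhenomena.PercolationContinuityZ3.Theorems.PercNearOneGluingNoHeavyLowerTailSunflowerMultiPetalKempeMarkedUnpairedOne
import HarnessLib
import HarnessLib.Audit

/-!
# `NoHeavyLowerTail` (crux stmt-CriticalPhenomena-4575), marked-multigraph layer: the unpaired step at outer degrees ONE and ZERO, row by row and for `TI_{P,Q}`

Support file (seat `prim-l12-p2` gen 54; `--supports stmt-CriticalPhenomena-4575`; sequel of `…KempeMarkedUnpairedOne` and `…KempeMarkedUnpairedTI`).  No `sorry`; nothing is
asserted about the crux.  Memo: run/shared/lean/prim/prim-l12/prim-l12-p2/FINDING-g54-UNPAIRED-ALL-D-LAW.md §2–§3.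

* `TfunF_step_unpaired_one` — the `|S| = 1` unpaired law (`TfunM_step_unpaired_one`) for every filtered functional `T_Φ` with `Φ` ignoring the colours of `s` and `y`
  (its rows are the triples `ρ[s ↦ 0,1,2]`, each nonnegative by the finite table `rowU1_nonneg`);
* `TIw_step_unpaired_one` — the same law for `TIw = 2^{|P|+|Q|}·TI_{P,Q}` with special sets avoiding `{s, y}`;
* `three_mul_TfunF_eq_of_pendant`, `three_mul_TIw_eq_of_pendant` — outer degree ZERO (`N(y) ⊆ {u,v}`): the exact identity
  `3·T_Φ(K) = T_Φ(K−y) + T_Φ((K−y)⁺^{mul y u·u}) + T_Φ((K−y)⁺^{mul y v·v})` (realised on `V`, `K−y = K.isolate y`) and its `TIw` form.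
Together with `TIw_step_unpaired` (`|S| ≥ 2`, `y ≁ v`) and `TIw_step_unpaired_both` (`y ∼ u, v`) the tree now contains, for EVERY unmarked non-special `y ∼ u` whose other
neighbours are non-special, an expression of `TI_{P,Q}(K)` as dominating a nonnegative combination of `TI_{P,Q}` of graphs with fewer active vertices (memo §3).
-/

namespace Summit.CriticalPhenomena.PercolationContinuityZ3.Theorems.SunflowerPartition.Kempe

open Finset

namespace MGraph

variable {V : Type*} [Fintype V] [LinearOrder V] (K : MGraph V)

section OneFilter

variable (Φ : (V → Fin 3) → Prop) [DecidablePred Φ]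
variable {K}
variable {u v y s : V}

/-- **The `|S| = 1` unpaired law ROW BY ROW**: for `Φ` ignoring the colours of `s` and `y` (`y ∼ u` unmarked, `y ≁ v`, `S = {s}`),
`12·T_Φ(K.isolate y) + 2·T_Φ(K.peelContract y {s} u) + 3·T_Φ((K.peelContract y {s} v)⁺ᵘ) + 3·T_Φ((K.isolate y)⁺ᵘ) ≤ 27·T_Φ(K)`. [this work] -/
theorem TfunF_step_unpaired_one (huv : u ≠ v) (hyu : y ≠ u) (hyv : y ≠ v) (hmark : K.mark y = 0) (hadj : K.mul y u ≠ 0) (hfar : K.mul y v = 0)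
    (hS : ∀ w, w ∈ ({s} : Finset V) ↔ (w ≠ u ∧ w ≠ v ∧ w ≠ y ∧ K.mul y w ≠ 0))
    (hΦ : ∀ z, (z = y ∨ z = s) → ∀ σ c, Φ (Function.update σ z c) ↔ Φ σ) :
    12 * (K.isolate y).TfunF Φ u v + 2 * (K.peelContract y {s} u).TfunF Φ u v + 3 * ((K.peelContract y {s} v).addMark u 1).TfunF Φ u v
      + 3 * ((K.isolate y).addMark u 1).TfunF Φ u v ≤ 27 * K.TfunF Φ u v := by
  have hsu : s ≠ u := ((hS s).1 (mem_singleton_self s)).1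
  have hsv : s ≠ v := ((hS s).1 (mem_singleton_self s)).2.1
  have hsy : s ≠ y := ((hS s).1 (mem_singleton_self s)).2.2.1
  have hys : K.mul y s ≠ 0 := ((hS s).1 (mem_singleton_self s)).2.2.2
  have huS : u ∉ ({s} : Finset V) := fun h => hsu (mem_singleton.1 h).symm
  have hvS : v ∉ ({s} : Finset V) := fun h => hsv (mem_singleton.1 h).symm
  have hyS : y ∉ ({s} : Finset V) := fun h => hsy (mem_singleton.1 h).symm
  have hΦy : ∀ σ c, Φ (Function.update σ y c) ↔ Φ σ := hΦ y (Or.inl rfl)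
  have hΦs : ∀ σ c, Φ (Function.update σ s c) ↔ Φ σ := hΦ s (Or.inr rfl)
  have hΦS : ∀ z ∈ ({s} : Finset V), ∀ σ c, Φ (Function.update σ z c) ↔ Φ σ := fun z hz => by rw [mem_singleton.1 hz]; exact hΦs
  have hA : cap3 (K.mul y u) ≠ 0 := fun h => hadj ((eq_zero_iff_cap3 _).2 h)
  have hC : cap3 (K.mul y s) ≠ 0 := fun h => hys ((eq_zero_iff_cap3 _).2 h)
  set P := (fun ρ : V → Fin 3 => (ρ u = 0 ∧ ρ v = 1) ∧ Φ ρ) with hP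
  have hPs : ∀ σ c, P (Function.update σ s c) ↔ P σ := fun σ c => by
    simp only [hP, Function.update_of_ne hsu.symm, Function.update_of_ne hsv.symm, hΦs σ c]
  -- (1) rows: Σ_P Σ_c res1(ρ[s↦c]) = 3·Σ_P res1
  have h3 : ∀ c : Fin 3, ∑ ρ ∈ univ.filter P, K.res1 y s (Function.update ρ s c) = 3 * ∑ ρ ∈ univ.filter (fun ρ => P ρ ∧ ρ s = c), K.res1 y s ρ := by
    intro c
    have h3a := sum_filter_eq_three_mul s P hPs (fun ρ => K.res1 y s (Function.update ρ s c)) (fun σ c' => by simp only [Function.update_idem])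
      (fun _ => c) (fun _ _ => rfl)
    have h3b : ∑ ρ ∈ univ.filter (fun ρ => P ρ ∧ ρ s = c), K.res1 y s (Function.update ρ s c)
        = ∑ ρ ∈ univ.filter (fun ρ => P ρ ∧ ρ s = c), K.res1 y s ρ := by
      refine sum_congr rfl fun ρ hρ => ?_
      have : ρ s = c := ((mem_filter.1 hρ).2).2
      rw [← this, Function.update_eq_self]
    rw [h3a, h3b]
  have hfib : ∑ ρ ∈ univ.filter P, K.res1 y s ρ = ∑ c : Fin 3, ∑ ρ ∈ univ.filter (fun ρ => P ρ ∧ ρ s = c), K.res1 y s ρ := by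
    rw [← sum_fiberwise (univ.filter P) (fun σ => σ s) (fun ρ => K.res1 y s ρ)]
    refine sum_congr rfl fun c _ => sum_congr ?_ fun _ _ => rfl
    ext σ
    simp only [mem_filter, mem_univ, true_and]
  have hrow : ∑ ρ ∈ univ.filter P, ∑ c : Fin 3, K.res1 y s (Function.update ρ s c) = 3 * ∑ ρ ∈ univ.filter P, K.res1 y s ρ := by
    have hc : ∑ ρ ∈ univ.filter P, ∑ c : Fin 3, K.res1 y s (Function.update ρ s c) = ∑ c : Fin 3, ∑ ρ ∈ univ.filter P, K.res1 y s (Function.update ρ s c) :=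
      sum_comm
    rw [hc, Fin.sum_univ_three, h3 0, h3 1, h3 2, hfib, Fin.sum_univ_three]
    ring
  have hrows : 0 ≤ ∑ ρ ∈ univ.filter P, ∑ c : Fin 3, K.res1 y s (Function.update ρ s c) := by
    refine sum_nonneg fun ρ hρ => ?_
    obtain ⟨⟨hu, hv⟩, -⟩ := (mem_filter.1 hρ).2
    rw [sum_res1_update_eq hS huv hyu hyv hmark ρ hu hv, hfar, cap3_zero]
    exact rowU1_nonneg _ _ _ _ hA hC
  rw [hrow] at hrows
  -- (2) the five sums
  have hker := K.sum_kerTAbs_filter Φ y u v hyu.symm hyv.symm hΦy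
  have hiso : ∑ ρ ∈ univ.filter P, fC ((K.isolate y).ctypeM ρ) = (K.isolate y).TfunF Φ u v := rfl
  have hzero : ∑ ρ ∈ univ.filter P, (if ρ s = 0 then fC ((K.isolate y).ctypeM ρ) else 0) = K.allZeroSumF Φ y {s} u v := by
    unfold allZeroSumF
    refine sum_congr rfl fun ρ _ => if_congr ?_ rfl rfl
    simp only [mem_singleton, forall_eq]
  have hpeel := K.TfunF_peelContract Φ y u v {s} hyu.symm huS hvS hyS hΦS
  have hmarkU : ((K.isolate y).addMark u 1).TfunF Φ u v = ∑ ρ ∈ univ.filter P, fC (ctAdd ((K.isolate y).ctypeM ρ) (1, 0, 0)) := by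
    have e0 : ((K.isolate y).addMark u 1).TfunF Φ u v = ∑ ρ ∈ univ.filter P, fC (((K.isolate y).addMark u 1).ctypeM ρ) := rfl
    rw [e0]
    refine sum_congr rfl fun ρ hρ => ?_
    rw [(K.isolate y).ctypeM_addMark u 1 ρ, ((mem_filter.1 hρ).2).1.1, xPart_zero_mark]
  -- the v-contracted, u-marked minor (pin s to the colour of v)
  have hone : ((K.peelContract y {s} v).addMark u 1).TfunF Φ u v
      = 3 * ∑ ρ ∈ univ.filter P, (if ρ s = 1 then fC (ctAdd ((K.isolate y).ctypeM ρ) (1, 0, 0)) else 0) := by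
    set L := K.peelContract y {s} v with hL
    have hZ : ∀ z ∈ ({s} : Finset V), (L.addMark u 1).IsFree z := fun z hz => by
      rw [mem_singleton.1 hz]
      exact L.isFree_addMark u 1 (K.isFree_peelContract_of_mem y v {s} (mem_singleton_self s)) hsu
    have h2 := (L.addMark u 1).sum_filter_eq_pow_mul fC {s} hZ P
      (fun z hz σ c => by rw [mem_singleton.1 hz]; exact hPs σ c) (fun _ _ => 1) (fun _ _ _ _ _ _ => rfl)
    have h3 : ∑ σ ∈ univ.filter (fun σ : V → Fin 3 => P σ ∧ ∀ z ∈ ({s} : Finset V), σ z = (1 : Fin 3)), fC ((L.addMark u 1).ctypeM σ)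
        = ∑ σ ∈ univ.filter (fun σ : V → Fin 3 => P σ ∧ ∀ z ∈ ({s} : Finset V), σ z = (1 : Fin 3)), fC (ctAdd ((K.isolate y).ctypeM σ) (1, 0, 0)) := by
      refine sum_congr rfl fun σ hσ => ?_
      obtain ⟨⟨⟨hu, hv⟩, -⟩, hz⟩ := (mem_filter.1 hσ).2
      rw [L.ctypeM_addMark u 1 σ, hu, xPart_zero_mark, hL,
        K.ctypeM_peelContract_of_const y v {s} hyv.symm hvS hyS σ (fun z hz' => by rw [hz z hz', hv])]
    have h4 : ∑ σ ∈ univ.filter (fun σ : V → Fin 3 => P σ ∧ ∀ z ∈ ({s} : Finset V), σ z = (1 : Fin 3)), fC (ctAdd ((K.isolate y).ctypeM σ) (1, 0, 0))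
        = ∑ ρ ∈ univ.filter P, (if ρ s = 1 then fC (ctAdd ((K.isolate y).ctypeM ρ) (1, 0, 0)) else 0) := by
      rw [sum_filter, sum_filter]
      refine sum_congr rfl fun σ _ => ?_
      by_cases hPσ : P σ
      · by_cases hQ : σ s = 1
        · rw [if_pos ⟨hPσ, fun z hz => by rw [mem_singleton.1 hz, hQ]⟩, if_pos hPσ, if_pos hQ]
        · rw [if_neg (fun h => hQ (h.2 s (mem_singleton_self s))), if_pos hPσ, if_neg hQ]
      · rw [if_neg (fun h => hPσ h.1), if_neg hPσ]
    have e0 : (L.addMark u 1).TfunF Φ u v = ∑ σ ∈ univ.filter P, fC ((L.addMark u 1).ctypeM σ) := rfl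
    rw [e0, h2, h3, h4, card_singleton, pow_one]
  have hsum : ∑ ρ ∈ univ.filter P, K.res1 y s ρ = 3 * (3 * K.TfunF Φ u v - (K.isolate y).TfunF Φ u v) - (K.isolate y).TfunF Φ u v
      - 2 * K.allZeroSumF Φ y {s} u v - 3 * ∑ ρ ∈ univ.filter P, (if ρ s = 1 then fC (ctAdd ((K.isolate y).ctypeM ρ) (1, 0, 0)) else 0)
      - ((K.isolate y).addMark u 1).TfunF Φ u v := by
    unfold res1
    rw [sum_sub_distrib, sum_sub_distrib, sum_sub_distrib, sum_sub_distrib, ← mul_sum, ← mul_sum, ← mul_sum, hker, hiso, hzero, hmarkU]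
  rw [hsum] at hrows
  rw [hpeel, hone, card_singleton, pow_one]
  linarith

/-- **OUTER DEGREE ZERO is an identity** (for `Φ` ignoring the colour of `y`; `y` unmarked with `N(y) ⊆ {u, v}`):
`3·T_Φ(K) = T_Φ(K.isolate y) + T_Φ((K.isolate y)⁺^{mul y u · u}) + T_Φ((K.isolate y)⁺^{mul y v · v})`. [this work] -/
theorem three_mul_TfunF_eq_of_pendant (huv : u ≠ v) (hyu : y ≠ u) (hyv : y ≠ v) (hmark : K.mark y = 0) (hnone : ∀ w, w ≠ u → w ≠ v → K.mul y w = 0)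
    (hΦy : ∀ σ c, Φ (Function.update σ y c) ↔ Φ σ) :
    3 * K.TfunF Φ u v = (K.isolate y).TfunF Φ u v + ((K.isolate y).addMark u (K.mul y u)).TfunF Φ u v + ((K.isolate y).addMark v (K.mul y v)).TfunF Φ u v := by
  set P := (fun ρ : V → Fin 3 => (ρ u = 0 ∧ ρ v = 1) ∧ Φ ρ) with hP
  have hker := K.sum_kerTAbs_filter Φ y u v hyu.symm hyv.symm hΦy
  -- the profile of y is (mul y u, mul y v, 0) ∧ 2 at every terminal-coloured colouring
  have hprof : ∀ ρ : V → Fin 3, ρ u = 0 → ρ v = 1 → K.profM y ρ = (cap3 (K.mul y u), cap3 (K.mul y v), 0) := by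
    intro ρ hu hv
    have hl : ∀ c, K.linkM y ρ c = (if (0 : Fin 3) = c then K.mul y u else 0) + (if (1 : Fin 3) = c then K.mul y v else 0) := by
      intro c
      unfold linkM
      rw [← Finset.sum_erase_add _ _ (mem_univ u), ← Finset.sum_erase_add _ _ (mem_erase.2 ⟨huv.symm, mem_univ v⟩), hu, hv]
      have hz : ∑ w ∈ (univ.erase u).erase v, (if ρ w = c then K.mul y w else 0) = 0 :=
        sum_eq_zero fun w hw => by
          have hwv : w ≠ v := (mem_erase.1 hw).1
          have hwu : w ≠ u := (mem_erase.1 (mem_erase.1 hw).2).1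
          rw [hnone w hwu hwv]; simp
      rw [hz, zero_add, add_comm]
    unfold profM
    rw [hl 0, hl 1, hl 2, hmark]
    simp
    rfl
  have e1 : ∑ ρ ∈ univ.filter P, kerTAbs ((K.isolate y).ctypeM ρ) (K.profM y ρ)
      = ∑ ρ ∈ univ.filter P, (fC (ctAdd ((K.isolate y).ctypeM ρ) (cap3 (K.mul y u), 0, 0)) + fC (ctAdd ((K.isolate y).ctypeM ρ) (0, cap3 (K.mul y v), 0))) := by
    refine sum_congr rfl fun ρ hρ => ?_
    obtain ⟨⟨hu, hv⟩, -⟩ := (mem_filter.1 hρ).2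
    rw [hprof ρ hu hv, kerTAbs_profile_no_two]
  have eu : ((K.isolate y).addMark u (K.mul y u)).TfunF Φ u v = ∑ ρ ∈ univ.filter P, fC (ctAdd ((K.isolate y).ctypeM ρ) (cap3 (K.mul y u), 0, 0)) := by
    have e0 : ((K.isolate y).addMark u (K.mul y u)).TfunF Φ u v = ∑ ρ ∈ univ.filter P, fC (((K.isolate y).addMark u (K.mul y u)).ctypeM ρ) := rfl
    rw [e0]
    refine sum_congr rfl fun ρ hρ => ?_
    rw [(K.isolate y).ctypeM_addMark u _ ρ, ((mem_filter.1 hρ).2).1.1, xPart_zero_diag]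
  have ev : ((K.isolate y).addMark v (K.mul y v)).TfunF Φ u v = ∑ ρ ∈ univ.filter P, fC (ctAdd ((K.isolate y).ctypeM ρ) (0, cap3 (K.mul y v), 0)) := by
    have e0 : ((K.isolate y).addMark v (K.mul y v)).TfunF Φ u v = ∑ ρ ∈ univ.filter P, fC (((K.isolate y).addMark v (K.mul y v)).ctypeM ρ) := rfl
    rw [e0]
    refine sum_congr rfl fun ρ hρ => ?_
    rw [(K.isolate y).ctypeM_addMark v _ ρ, ((mem_filter.1 hρ).2).1.2, xPart_one_diag]
  rw [e1, sum_add_distrib, ← eu, ← ev] at hker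
  linarith

end OneFilter

section OneTI

variable {K}
variable {u v y s : V}

/-- **The `|S| = 1` unpaired law for `TI_{P,Q}`** (special sets avoiding `{s, y}`). [this work] -/
theorem TIw_step_unpaired_one (huv : u ≠ v) (hyu : y ≠ u) (hyv : y ≠ v) (hmark : K.mark y = 0) (hadj : K.mul y u ≠ 0) (hfar : K.mul y v = 0)
    (hS : ∀ w, w ∈ ({s} : Finset V) ↔ (w ≠ u ∧ w ≠ v ∧ w ≠ y ∧ K.mul y w ≠ 0))
    (P Q : Finset V) (hP : ∀ z, (z = y ∨ z = s) → z ∉ P) (hQ : ∀ z, (z = y ∨ z = s) → z ∉ Q) :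
    12 * (K.isolate y).TIw P Q u v + 2 * (K.peelContract y {s} u).TIw P Q u v + 3 * ((K.peelContract y {s} v).addMark u 1).TIw P Q u v
      + 3 * ((K.isolate y).addMark u 1).TIw P Q u v ≤ 27 * K.TIw P Q u v := by
  have hsu : s ≠ u := ((hS s).1 (mem_singleton_self s)).1
  have hsv : s ≠ v := ((hS s).1 (mem_singleton_self s)).2.1
  have huS : u ∉ ({s} : Finset V) := fun h => hsu (mem_singleton.1 h).symm
  have hvS : v ∉ ({s} : Finset V) := fun h => hsv (mem_singleton.1 h).symm
  set t := (range (P.card + 1)) ×ˢ (range (Q.card + 1)) with ht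
  let Φ : ℕ × ℕ → (V → Fin 3) → Prop := fun p σ => iCount P σ = p.1 ∧ jCount Q σ = p.2
  let wt : ℕ × ℕ → ℤ := fun p => 2 ^ (P.card - p.1) * 2 ^ (Q.card - p.2)
  let Kp : ℕ × ℕ → MGraph V := fun p => (K.addMark u p.1).addMark v p.2
  have hwt : ∀ p, 0 ≤ wt p := fun p => by positivity
  have hΦ : ∀ p z, (z = y ∨ z = s) → ∀ σ c, Φ p (Function.update σ z c) ↔ Φ p σ := fun p z hz σ c => by
    simp only [Φ, iCount_update P σ (hP z hz) c, jCount_update Q σ (hQ z hz) c]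
  have hE : ∀ p ∈ t,
      wt p * (12 * ((Kp p).isolate y).TfunF (Φ p) u v + 2 * ((Kp p).peelContract y {s} u).TfunF (Φ p) u v
        + 3 * (((Kp p).peelContract y {s} v).addMark u 1).TfunF (Φ p) u v + 3 * (((Kp p).isolate y).addMark u 1).TfunF (Φ p) u v)
      ≤ wt p * (27 * (Kp p).TfunF (Φ p) u v) := by
    intro p _
    refine mul_le_mul_of_nonneg_left ?_ (hwt p)
    have hmark' : (Kp p).mark y = 0 := by
      simp only [Kp, mark_addMark, if_neg hyv, if_neg hyu, add_zero, hmark]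
    have hadj' : (Kp p).mul y u ≠ 0 := by simpa only [Kp, mul_addMark] using hadj
    have hfar' : (Kp p).mul y v = 0 := by simpa only [Kp, mul_addMark] using hfar
    have hS' : ∀ z, z ∈ ({s} : Finset V) ↔ (z ≠ u ∧ z ≠ v ∧ z ≠ y ∧ (Kp p).mul y z ≠ 0) := fun z => by simpa only [Kp, mul_addMark] using hS z
    exact TfunF_step_unpaired_one (Φ p) huv hyu hyv hmark' hadj' hfar' hS' (hΦ p)
  have hsum := sum_le_sum hE
  have e1 : ∀ p, (Kp p).isolate y = ((K.isolate y).addMark u p.1).addMark v p.2 := fun p => by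
    simp only [Kp, isolate_addMark _ v y hyv.symm, isolate_addMark _ u y hyu.symm]
  have e2 : ∀ p, (Kp p).peelContract y {s} u = ((K.peelContract y {s} u).addMark u p.1).addMark v p.2 := fun p => by
    simp only [Kp, peelContract_addMark _ v y u {s} _ hyv.symm hvS, peelContract_addMark _ u y u {s} _ hyu.symm huS]
  have e3 : ∀ p, ((Kp p).peelContract y {s} v).addMark u 1 = ((((K.peelContract y {s} v).addMark u 1)).addMark u p.1).addMark v p.2 := fun p => by
    simp only [Kp]
    rw [peelContract_addMark _ v y v {s} _ hyv.symm hvS, peelContract_addMark _ u y v {s} _ hyu.symm huS,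
      addMark_addMark_comm _ v u, addMark_addMark_comm _ u u p.1 1]
  have e4 : ∀ p : ℕ × ℕ, (((K.isolate y).addMark u p.1).addMark v p.2).addMark u 1 = (((K.isolate y).addMark u 1).addMark u p.1).addMark v p.2 := fun p => by
    rw [addMark_addMark_comm _ v u p.2 1, addMark_addMark_comm (K.isolate y) u u p.1 1]
  rw [K.TIw_eq_sum_classes P Q u v, (K.isolate y).TIw_eq_sum_classes P Q u v, (K.peelContract y {s} u).TIw_eq_sum_classes P Q u v,
    ((K.peelContract y {s} v).addMark u 1).TIw_eq_sum_classes P Q u v, ((K.isolate y).addMark u 1).TIw_eq_sum_classes P Q u v]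
  rw [← ht, mul_sum, mul_sum, mul_sum, mul_sum, mul_sum, ← sum_add_distrib, ← sum_add_distrib, ← sum_add_distrib]
  refine le_trans (le_of_eq ?_) (le_trans hsum (le_of_eq ?_))
  · refine sum_congr rfl fun p _ => ?_
    rw [e1 p, e2 p, e3 p, e4 p]
    simp only [wt, Φ]
    ring
  · refine sum_congr rfl fun p _ => ?_
    simp only [Kp, wt, Φ]
    ring

/-- **Outer degree zero for `TI_{P,Q}`** (special sets avoiding `y`): `3·TIw(K) = TIw(K.isolate y) + TIw((K.isolate y)⁺^{mul y u·u}) + TIw((K.isolate y)⁺^{mul y v·v})`. [this work] -/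
theorem three_mul_TIw_eq_of_pendant (huv : u ≠ v) (hyu : y ≠ u) (hyv : y ≠ v) (hmark : K.mark y = 0) (hnone : ∀ w, w ≠ u → w ≠ v → K.mul y w = 0)
    (P Q : Finset V) (hP : y ∉ P) (hQ : y ∉ Q) :
    3 * K.TIw P Q u v = (K.isolate y).TIw P Q u v + ((K.isolate y).addMark u (K.mul y u)).TIw P Q u v + ((K.isolate y).addMark v (K.mul y v)).TIw P Q u v := by
  set t := (range (P.card + 1)) ×ˢ (range (Q.card + 1)) with ht
  let Φ : ℕ × ℕ → (V → Fin 3) → Prop := fun p σ => iCount P σ = p.1 ∧ jCount Q σ = p.2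
  let Kp : ℕ × ℕ → MGraph V := fun p => (K.addMark u p.1).addMark v p.2
  have hΦ : ∀ p σ c, Φ p (Function.update σ y c) ↔ Φ p σ := fun p σ c => by
    simp only [Φ, iCount_update P σ hP c, jCount_update Q σ hQ c]
  have hE : ∀ p ∈ t, 3 * (Kp p).TfunF (Φ p) u v
      = ((Kp p).isolate y).TfunF (Φ p) u v + (((Kp p).isolate y).addMark u (K.mul y u)).TfunF (Φ p) u v
        + (((Kp p).isolate y).addMark v (K.mul y v)).TfunF (Φ p) u v := by
    intro p _
    have hmark' : (Kp p).mark y = 0 := by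
      simp only [Kp, mark_addMark, if_neg hyv, if_neg hyu, add_zero, hmark]
    have hnone' : ∀ w, w ≠ u → w ≠ v → (Kp p).mul y w = 0 := fun w hwu hwv => by simpa only [Kp, mul_addMark] using hnone w hwu hwv
    have h := three_mul_TfunF_eq_of_pendant (Φ p) (K := Kp p) huv hyu hyv hmark' hnone' (hΦ p)
    simpa only [Kp, mul_addMark] using h
  have e1 : ∀ p, (Kp p).isolate y = ((K.isolate y).addMark u p.1).addMark v p.2 := fun p => by
    simp only [Kp, isolate_addMark _ v y hyv.symm, isolate_addMark _ u y hyu.symm]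
  have e2 : ∀ p, ((Kp p).isolate y).addMark u (K.mul y u) = (((K.isolate y).addMark u (K.mul y u)).addMark u p.1).addMark v p.2 := fun p => by
    rw [e1 p, addMark_addMark_comm _ v u, addMark_addMark_comm _ u u p.1 (K.mul y u)]
  have e3 : ∀ p, ((Kp p).isolate y).addMark v (K.mul y v) = (((K.isolate y).addMark v (K.mul y v)).addMark u p.1).addMark v p.2 := fun p => by
    rw [e1 p, addMark_addMark_comm _ v v p.2 (K.mul y v), addMark_addMark_comm _ u v p.1 (K.mul y v)]
  rw [K.TIw_eq_sum_classes P Q u v, (K.isolate y).TIw_eq_sum_classes P Q u v, ((K.isolate y).addMark u (K.mul y u)).TIw_eq_sum_classes P Q u v,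
    ((K.isolate y).addMark v (K.mul y v)).TIw_eq_sum_classes P Q u v]
  rw [← ht, mul_sum, ← sum_add_distrib, ← sum_add_distrib]
  refine sum_congr rfl fun p hp => ?_
  have h := hE p hp
  rw [e2 p, e3 p, e1 p] at h
  simp only [Kp, Φ] at h ⊢
  rw [mul_left_comm, h]
  ring

end OneTI

end MGraph

end Summit.CriticalPhenomena.PercolationContinuityZ3.Theorems.SunflowerPartition.Kempe
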